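import Summits.CriticalPhenomena.CardyFormulaZ2.Theorems.CardyBoundaryCoulombGasHalfPlaneMarkDensityLawPosNearestLeftShift

/-!
# `HalfPlaneMarkDensityLaw` (crux stmt-CriticalPhenomena-5661), line `Sketch`, NearEndPos N2:
# stub `stub_nearRight_shift` — translation invariance of the near-right event

For `k ∈ ℤ` let `NR(k; rlo, rhi; slo)` be the event that `(k,0)` is joined inside the lattice
half-plane `H = ℤ × ℕ` to some `(r,0)` with `rlo ≤ r ≤ rhi` and to no `(s,0)` with `slo ≤ s < k`.
The events `NR(k; rlo + k, rhi + k; slo + k)` and `NR(0; rlo, rhi; slo)` are horizontal translates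
of one another: the relabelling `ω ↦ ω + (k,0)` of bond configurations
(`BondConfig.relabel (sym2Equiv (Site.shift (k,0)))`) pulls the former back to the latter
(`Positivity.nlShift_relabel_mem_openConnIn_iff`, the transport helper of the cycle-4 mirror
image `stub_nearestLeft_shift`), and `P_{1/2}` on `ℤ²` is translation invariant
(`bondPercolation_real_preimage_shift`). Hence the two events are equiprobable.
-/

noncomputable section

namespace Summit.CriticalPhenomena.CardyFormulaZ2.Cruxes.HalfPlaneMarkDensityLaw.SketchLine

open Literature.Probability.Percolation Literature.Probability.LatticeModels
open MeasureTheory Filter Set SimpleGraph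
open scoped Topology
open Summit.CriticalPhenomena.CardyFormulaZ2.Theorems.HalfPlaneMarkDensityLaw.Negative

namespace NearEndPos

/-- The shift by `(k,0)` pulls the near-right event at `(k,0)` with target window
`[rlo+k, rhi+k]` and excluded arc `[slo+k, k)` back to the near-right event at the origin with
target window `[rlo, rhi]` and excluded arc `[slo, 0)`. [folklore] -/
theorem nrShift_preimage_relabel_nearRight (k rlo rhi slo : ℤ) :
    BondConfig.relabel (sym2Equiv (Site.shift (bpt k))) ⁻¹'
        {ω : BondConfig (Site 2) | (∃ r : ℤ, rlo + k ≤ r ∧ r ≤ rhi + k ∧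
          ω ∈ openConnIn halfPlane (bpt (k)) (bpt r)) ∧
            ∀ s : ℤ, slo + k ≤ s → s < k → ω ∉ openConnIn halfPlane (bpt (k)) (bpt s)} =
      {ω : BondConfig (Site 2) | (∃ r : ℤ, rlo ≤ r ∧ r ≤ rhi ∧
        ω ∈ openConnIn halfPlane (bpt (0)) (bpt r)) ∧
          ∀ s : ℤ, slo ≤ s → s < 0 → ω ∉ openConnIn halfPlane (bpt (0)) (bpt s)} := by
  ext ω
  simp only [Set.mem_preimage, Set.mem_setOf_eq]
  constructor
  · rintro ⟨⟨r, hlo, hhi, hconn⟩, hno⟩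
    refine ⟨⟨r - k, by omega, by omega,
      (Positivity.nlShift_relabel_mem_openConnIn_iff k r ω).1 hconn⟩, fun s hlos hs0 hs ↦ ?_⟩
    refine hno (s + k) (by omega) (by omega)
      ((Positivity.nlShift_relabel_mem_openConnIn_iff k (s + k) ω).2 ?_)
    rwa [add_sub_cancel_right]
  · rintro ⟨⟨r, hlo, hhi, hconn⟩, hno⟩
    refine ⟨⟨r + k, by omega, by omega,
      (Positivity.nlShift_relabel_mem_openConnIn_iff k (r + k) ω).2
        (by rwa [add_sub_cancel_right])⟩, fun s hlos hsk hs ↦ ?_⟩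
    exact hno (s - k) (by omega) (by omega)
      ((Positivity.nlShift_relabel_mem_openConnIn_iff k s ω).1 hs)

/-- STUB N2 (translation invariance of the `NR` event): the near-right event at `(k,0)` with
target window `[rlo+k, rhi+k]` and excluded arc `[slo+k, k)` and the near-right event at the
origin with target window `[rlo, rhi]` and excluded arc `[slo, 0)` are lattice translates of one
another, hence equiprobable under `P_{1/2}`. [folklore] -/
theorem stub_nearRight_shift :
    ∀ (k rlo rhi slo : ℤ),
      μ.real {ω : BondConfig (Site 2) | (∃ r : ℤ, rlo + k ≤ r ∧ r ≤ rhi + k ∧ ω ∈ openConnIn halfPlane (bpt (k)) (bpt r)) ∧ ∀ s : ℤ, slo + k ≤ s → s < k → ω ∉ openConnIn halfPlane (bpt (k)) (bpt s)} =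
      μ.real {ω : BondConfig (Site 2) | (∃ r : ℤ, rlo ≤ r ∧ r ≤ rhi ∧ ω ∈ openConnIn halfPlane (bpt (0)) (bpt r)) ∧ ∀ s : ℤ, slo ≤ s → s < 0 → ω ∉ openConnIn halfPlane (bpt (0)) (bpt s)} := by
  intro k rlo rhi slo
  rw [← nrShift_preimage_relabel_nearRight k rlo rhi slo]
  unfold μ
  exact (bondPercolation_real_preimage_shift (bpt k) half _).symm

end NearEndPos

end Summit.CriticalPhenomena.CardyFormulaZ2.Cruxes.HalfPlaneMarkDensityLaw.SketchLine
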